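import Mathlib
import HarnessLib
import HarnessLib.Audit
import Summits.Parity.Statement
import Summits.Parity.BatemanHorn.Theorems.IsogenyRedeiTypeIMainTerm
import Summits.Parity.BatemanHorn.Theorems.IsogenyRedeiLambdaToCount
import HarnessLib.Audit.Status.Attr

/-!
Route: CrossedSalie

DORMANT since 2026-08-24T17:55:32Z (reconciler: no traction for 6.9 d (last activity item-evidence-added at 2026-08-17T18:31:59Z); parked, not closed — `ledger route dormant route-Parity-CrossedSalie --off` to reactivate) — unstaffed, not closed; items shared with open routes are served there. `ledger route dormant <id> --off` reactivates.

# Route CrossedSalie — n²+1, n²+3 both prime = the (X²+1)(X²+3)-slice of the Möbius-tail frame, cut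
by one Λ₂-tail into a crossed-Salié bilinear piece, twisted k=1 tails and a joint cofactor atom

It suffices to show X = X_PM, the MÖBIUS-TAIL frame of route PolynomialMobius, re-wanted verbatim
(target PolyMobiusTail =
stmt-Parity-0870; theorem-grade glue TypeIMainTerm = 0873, LambdaToCount = 0874): for every
Bateman–Horn system f = (f₁,…,f_k)
there is η ∈ (0,1) with Σ_{n≤x} Σ_{dᵢ ∣ fᵢ(n), d₁⋯d_k > x^{1−η}} ∏ μ(dᵢ) log dᵢ = o(x); the deciding
theorem
`closes : PolyMobiusTail → TypeIMainTerm → LambdaToCount → BatemanHorn` is PROVED in the file (Λ =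
−(μ·log)∗1 per coordinate,
split at ∏dᵢ ≤ x^{1−η}, IsEquivalent.add_isLittleO). This route is the §2.1-conforming successor of
TwoCMLines (retired
2026-08-15, not-a-thesis: its assembly stopped at BH for one pair) and realises card
two-cm-lines-crossed-salie (spine) on ONE
slice of X, the first with no linear member: k = 2, F = (X²+1, X²+3), typed as support TwoCmTail (=
X at (2, F) in
(d₁,d₂)-coordinates). Card mechanism: Λ(n²+1)Λ(n²+3) = Σ_{d₁∣n²+1, d₂∣n²+3} μ(d₁)log d₁·μ(d₂)log d₂
is ONE signed sum over the
divisors c = d₁d₂ of P(n) = (n²+1)(n²+3) (= ½Λ₂(P(n)) for even n; odd n give two even values), so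
the k = 1 small-root
template transfers with CRT-crossed Salié products S_{X²+1}(h d̄₂; d₁)·S_{X²+3}(h d̄₁; d₂) as Weyl
sums (support CrossedCRT);
the slice's tail region {d₁d₂ > x^{1−η}} is partitioned EXACTLY as CrossedMoebius (r3: d₁,d₂ ≤
x^{1−η}) ⊔ MixedTail (r6:
max dᵢ > x^{1−η}, min dᵢ ≤ x^{1+η}) ⊔ JointCofactor (r2: d₁,d₂ > x^{1+η}), and support SliceGlue:
CrossedMoebius → MixedTail →
JointCofactor → TwoCmTail is provable now; engine cruxes MixedDivisor (r4) and
QuarticRootsPowerSaving (r5) calibrate the new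
object and are off the deciding chain.
Lean: `∀ (k : ℕ) (f : Fin k → Polynomial ℤ), Literature.NumberTheory.Sieve.IsBatemanHornSystem f → ∃
η : ℝ, 0 < η ∧ η < 1 ∧ (fun x : ℕ => ∑ n ∈ Finset.Icc 1 x, ∑ d ∈ Fintype.piFinset (fun i => (((f
i).eval (n : ℤ)).toNat).divisors), if (x : ℝ) ^ (1 - η) < ∏ i, (d i : ℝ) then ∏ i,
((ArithmeticFunction.moebius (d i) : ℝ) * Real.log (d i)) else 0) =o[Filter.atTop] fun x : ℕ => (x :
ℝ)`

## Assembly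
The deciding theorem is `closes (hTail : PolyMobiusTail) (hMain : TypeIMainTerm) (hCount :
LambdaToCount) : _root_.BatemanHorn`,
PROVED in glue.lean / Sketch.lean (rc 0, no sorry): given k, f, IsBatemanHornSystem f, take η from
PolyMobiusTail and C from
TypeIMainTerm; per coordinate ∏ Λ(fᵢ(n)) = (−1)^k Σ_{d ∈ ∏ divisors(fᵢ(n))} ∏ μ(dᵢ) log dᵢ (Mathlib
ArithmeticFunction.sum_moebius_mul_log_eq,
Finset.prod_neg, Finset.prod_univ_sum); split the divisor sum at ∏dᵢ ≤ x^{1−η} (TypeIMainTerm: ~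
C·x) versus x^{1−η} < ∏dᵢ (tail: o(x)),
IsEquivalent.add_isLittleO, then LambdaToCount. Its hypotheses are three of the route's items and
nothing else; the Assembly item is
that implication (shared with PolynomialMobius 0875). How the cruxes bear on the frame — typed, not
only prose: SliceGlue proves
CrossedMoebius → MixedTail → JointCofactor → TwoCmTail, and TwoCmTail is the (2, F)-instance of
PolyMobiusTail; the honest gap is the
one a one-system card cannot close — all other slices of X stay with PolynomialMobius
(PolyMobiusAtom / PolyChowla) and the k = 1
engine routes. Import cone: no import beyond the gate boilerplate; no Literature fact is a
hypothesis of any item (Weyl sums inlined).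

Rationale: WHY THIS LINE. PROBLEMS.md §3 Parity bullet 3 ("structured polynomial instances") at k = 2: every
engine-bearing BatemanHorn route in the tree is
k = 1 (CyclotomicTower: n⁴+1; the retired QuadraticRoots/UnimodularColumns: n²+1; CubicRoots: degree
3) or engine-free for all
(k, f) (PolynomialMobius), and this line asks what is NEW when two CM quadratics must be prime
simultaneously, answering: one
bilinear object (crossed Salié sums coupling the root systems ν₁² ≡ −1 (d₁), ν₂² ≡ −3 (d₂) through
Kloosterman fractions
d̄₂/d₁, d̄₁/d₂) and one joint atom Σ μ(n²+1)μ(n²+3). Mechanism = the card's Λ₂/one-tail collapse +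
the Duke–Friedlander–Iwaniec
/ Tóth small-root machinery [DukeFriedlanderIwaniec1995, Toth2000, doi:10.1093/imrn/rnr112,
Hooley1964 Lemma 1], sharpened by
the gen-1 observation (kept) that a bilinear form with GENERAL bounded coefficients admits no saving
once one modulus exceeds 2x,
so all Type-II content sits with both moduli below x^{1−η} (CrossedMoebius; cf. the ranges of
arXiv:1908.08816 Prop. 4) while
everything with a modulus beyond x is k = 1 parity material (MixedTail) or the joint atom
(JointCofactor). Imported areas: GL₂
spectral theory of sums of Kloosterman/Salié sums and bilinear forms in Kloosterman fractions
[DeshouillersIwaniec1982,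
DukeFriedlanderIwaniec1997, doi:10.4171/jems/951, arXiv:1908.08816, arXiv:2505.00493]; CRT mixing
for reducible polynomials
[arXiv:2003.12965 Thm 2.1] and the tree's proof of Hooley 1964
(Literature.NumberTheory.Sieve.hooley_polyRoots_logPowerSaving_holds)
for the qualitative rung; the large sieve at quadratic roots
(Literature.NumberTheory.Sieve.largeSieve_quadraticRoots). What it
does that the retired TwoCMLines did not: it decides _root_.BatemanHorn (frame + proved `closes`),
types the slice (TwoCmTail) and
puts the region bookkeeping ON the typed chain (SliceGlue), and inlines the Weyl sums so that no
unproved Literature fact enters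
the import cone (the gen-1 import dragged dukeFriedlanderIwaniecToth_quadraticRoots_primeModuli in).
Negatives index (2 Parity
entries, both GeneralizedHardyLittlewood): nothing near these statements.

RANKED CRUXES. #0 PolyMobiusTail (target) — X_PM of route PolynomialMobius (stmt-Parity-0870),
re-wanted verbatim as this route's frame: for every Bateman–Horn system f = (f₁,…,f_k) there is η ∈
(0,1) with Σ_{n≤x} Σ_{dᵢ ∣ fᵢ(n), d₁⋯d_k > x^{1−η}} ∏ᵢ μ(dᵢ) log dᵢ = o(x). With TypeIMainTerm and
LambdaToCount it gives _root_.BatemanHorn (`closes`, proved). This route attacks its k = 2, F =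
(X²+1, X²+3) slice (support TwoCmTail), the first with no linear member. (why it might fail: =
BatemanHorn in Λ-form modulo theorem-grade glue (Bombieri's indeterminacy: no Type-I level < 1
decides it); false iff BH fails for some system — which happens verbatim over F_q[u] for inseparable
f (Conrad–Conrad–Gross).) [BombieriAsymptoticSieve1976, arXiv:2008.09905,
Literature.Barriers.Parity.FunctionFieldMobiusBias,
Literature.Barriers.Parity.FordFixedLevelBarrier]
#2 JointCofactor (crux) — card item Q₁₂, the joint cofactor atom of the F-slice: for every η ∈ (0,
1/4), Σ_{n≤x} Σ_{d₁ ∣ n²+1, d₂ ∣ n²+3, d₁ > x^{1+η}, d₂ > x^{1+η}} μ(d₁) log d₁ · μ(d₂) log d₂ =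
o(x). Cofactor reading: dᵢ = fᵢ(n)/eᵢ with eᵢ ≲ x^{1−η}, so this is Σ_{e₁,e₂} Σ_{n≤x: eᵢ ∣ fᵢ(n)}
μ((n²+1)/e₁)μ((n²+3)/e₂)·log·log = o(x): joint Möbius randomness of the two LARGE cofactors along
the joint root classes mod e₁e₂ ≤ x^{2−2η} (fewer than one n per class on average — a correlation
sum, not a progression statement); the (e₁,e₂) = (1,1) term is the log-weighted form of support
JointMoebiusAtom. Trivial bound ≍ x log⁴x, so a (log x)^{4+ε} saving is required. Any single η feeds
SliceGlue (which uses η = 1/8); the ∀η form is the intended robustness claim (refuted at one η ⇒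
re-cut, see Kill criteria). [difficulty: open-problem] (why it might fail: k=2 Chowla-type claim
along a quartic, open even for Σμ(n²+1)=o(x); a joint sign bias of μ((n²+1)/e₁)μ((n²+3)/e₂) on some
root classes (CCG-type, known over F_q[u]) gives Ω(x); needs a (log x)⁴ saving over the trivial
x·log⁴x, not just o(trivial).) [arXiv:2010.07924,
Literature.Barriers.Parity.FunctionFieldMobiusBias, arXiv:2008.09905, stmt-Parity-0871,
stmt-Parity-0615, REVIEW-TwoCMLines.md (refuter regional numerics to 1e6: |Joint piece|/x ≤ 0.27
with fluctuating sign)]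
#3 CrossedMoebius (crux) — card item W₁₂ in the only range where it is bilinear — the route's new
object: for every η ∈ (0, 1/4), Σ_{n≤x} Σ_{d₁ ∣ n²+1, d₂ ∣ n²+3, d₁ ≤ x^{1−η}, d₂ ≤ x^{1−η}, d₁d₂ >
x^{1−η}} μ(d₁) log d₁ · μ(d₂) log d₂ = o(x). Each progression n ≡ νᵢ (dᵢ) has ≥ x^η terms but the
joint modulus d₁d₂ reaches x^{2−2η} ≫ x; after Poisson in n the error is (x/d₁d₂)
Σ_{0<|h|≤d₁d₂/x^{1−ε}} Σ_{d₁,d₂} α(d₁)β(d₂) S_{X²+1}(h d̄₂; d₁) S_{X²+3}(h d̄₁; d₂) with α = β =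
μ·log (support CrossedCRT): a bilinear form in two root systems coupled by Kloosterman fractions.
The x·(main terms) cancel in the limit (A(Y)B(Y) − Σ_{d₁d₂≤Y}(a∗b) → A∞B∞ − A∞B∞ by the prime ideal
theorem in ℚ(i), ℚ(√−3)), so the content is the dual sum; lopsided parts (min dᵢ ≤ x^{η/2}) are Type
I, the heart is x^{η/2} ≤ d₁, d₂ ≤ x^{1−η}. [deps: CrossedCRT] [difficulty: XL] (why it might fail:
Balanced corner d₁≈d₂≈x^{1−η}: x^{1−2η} frequencies and a near-square-root saving in (d₁,d₂) are
needed; Cauchy–Schwarz halves savings (Merikoski Prop 4: Type II only for N<x^{0.26} at MN≈x), so μ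
must be opened into Type-I₂ at pair level x^{2−2η}, past MixedDivisor.) [arXiv:1908.08816,
doi:10.4171/jems/951, DukeFriedlanderIwaniec1995, DukeFriedlanderIwaniec1997,
Literature.NumberTheory.Sieve.largeSieve_quadraticRoots, FordMaynard2024PrimeSieves,
Literature.Barriers.Parity.LargeSieveLevelHalf, arXiv:2505.00493]
#4 MixedDivisor (crux) — the card's master Type-I₂ sum at LEADING ORDER ONLY (refuter caveat
accepted: not theorem-grade): there is c > 0 with Σ_{n≤x} τ(n²+1)·τ(n²+3) ~ c·x·log²x. For even n
this is τ(P(n)), P = (X²+1)(X²+3); the order x·log²x is classical (two irreducible factors), the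
constant is not: after flipping each factor at √fᵢ(n) ≈ n one needs #{n ≤ x : c₁ ∣ n²+1, c₂ ∣ n²+3}
for c₁, c₂ ≤ x with pair modulus c₁c₂ up to x², and the region c₁c₂ > x carries half of the
logarithmic mass — smooth-coefficient crossed Salié sums with frequencies h ≤ c₁c₂/x (fine-scale
joint equidistribution of the typed roots of P), which Σ τ(n)τ(n+1) (Ingham: pair level = length
after the flips) never needs. The power-saving form x·Q₂(log x) + O(x^{1−δ}) is the layer-2
endpoint. [deps: QuarticRootsPowerSaving] [difficulty: XL] (why it might fail: At c₁≈c₂≈x the dual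
sum has x³ terms (h,c₁,c₂) and must save a factor x with both moduli at the Pólya–Vinogradov edge;
no automorphic object for typed roots of the reducible quartic is known (Bykovskiĭ/Kuznetsov serve
one discriminant); even Στ(n²+1)² is open.) [Hooley1963, doi:10.1017/s0305004100073242,
doi:10.1016/j.jnt.2017.05.002, doi:10.1007/s11139-019-00240-2, doi:10.1515/crll.1999.507.107,
arXiv:1908.08816, TwoCMLines numerics (M(x)/(x log²x) = 1.978 / 1.879 / 1.821 / 1.784 at x = 10³ /
10⁴ / 10⁵ / 10⁶)]
#5 QuarticRootsPowerSaving (crux) — first rung of the engine, Weyl sum inlined (no Literature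
import; simp-equal to Σ_{c≤N} polyRootWeylSum ((X²+1)(X²+3)) c h, checked in ScratchWeyl.lean): for
every h ≠ 0 there is δ > 0 with Σ_{c ≤ N} S_P(h; c) = O(N^{1−δ}), S_P(h; c) = Σ_{ν mod c, P(ν) ≡ 0}
e(hν/c), P = (X²+1)(X²+3) (Σ_{c≤N} ρ_P(c) ≍ N log N). For squarefree c coprime to 6 the roots of P
are the CRT-glued pairs (root of X²+1 mod c₁, root of X²+3 mod c₂), c = c₁c₂ (odd p cannot divide
both values: they differ by 2), and S_P(h; c) = Σ_{c₁c₂ = c} S_{X²+1}(h c̄₂; c₁)·S_{X²+3}(h c̄₁;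
c₂): the smooth-coefficient crossed Salié sum at a fixed frequency. A power saving is in print only
for ONE irreducible quadratic (Hooley 1963 / Bykovskiĭ / Tóth via Weil–Kloosterman); for reducible
polynomials only linear-factor cases (Dartyge–Martin Thms 1–4). For fixed c₂, S_{X²+1}(h c̄₂; c₁) =
S_{c₂²X²+1}(h; c₁), so lopsided ranges are Hooley/Bykovskiĭ for the quadratics c₂²X²+1, c₁²X²+3 over
moduli in progressions, uniformly in the level; no secondary main term is expected (no rational
root; the residue of ν₂ mod c₂ washes out the twist). [deps: CrossedCRT,
QuarticRootsEquidistribution] [difficulty: L] (why it might fail: Balanced range c₁≈c₂≈√N: after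
Cauchy–Schwarz the off-diagonal is a length-√N sum of root Weyl sums twisted by Kloosterman
fractions of modulus ≈N with root-entangled numerators (DFI97 needs a fixed numerator); a secondary
term ≍N (as for n(n²+1), Dartyge–Martin Thm 2) falsifies the O-form.) [Hooley1964,
Literature.NumberTheory.Sieve.hooley_polyRoots_logPowerSaving_holds, arXiv:2003.12965,
arXiv:1802.09090, MartinSitar2010, DukeFriedlanderIwaniec1997, doi:10.1093/imrn/rnr112, Toth2000,
TwoCMLines numerics (|Σ_{c≤N} S_P(h, c)| ≤ 2.1√N for h = 1 or 2 or 5 and N ≤ 8000)]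
#6 MixedTail (crux) — card items Q′₁, Q′₂ and the beyond-x part of W₁₂: for every η ∈ (0, 1/4),
Σ_{n≤x} Σ_{d₁ ∣ n²+1, d₂ ∣ n²+3, max(d₁,d₂) > x^{1−η}, min(d₁,d₂) ≤ x^{1+η}} μ(d₁) log d₁ · μ(d₂)
log d₂ = o(x). Writing −Λ(fᵢ(n)) = Lᵢ + Wᵢ + Kᵢ (level d ≤ Y, window Y < d ≤ Z, cofactor d > Z
parts; Y = x^{1−η}, Z = x^{1+η}) this is Σ_n [L₁(W₂+K₂) + (W₁+K₁)L₂ + W₁W₂ + W₁K₂ + K₁W₂]: the k = 1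
window and cofactor statements of each factor along the root progressions n ≡ ν_j (d_j), d_j ≤
x^{1−η}, of the OTHER factor with weights μ(d_j) log d_j (cancellation across moduli allowed and
probably necessary), plus the balanced joint window W₁W₂ (d₁ ≈ d₂ ≈ x). Together with CrossedMoebius
and JointCofactor it partitions {d₁d₂ > x^{1−η}} exactly (support SliceGlue). [difficulty:
open-problem] (why it might fail: Contains HL-E-depth parity statements for each factor (Λ-tail of
n²+3 along μ-weighted root progressions of n²+1 and symmetrically); general coefficients provably
fail once a modulus exceeds 2x, so only the arithmetic of μ on the large divisor can give the log⁴
saving; no Type-II range there.) [stmt-Parity-0648, stmt-Parity-0649, stmt-Parity-0882,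
arXiv:2505.00493, FordMaynard2024PrimeSieves, Literature.Barriers.Parity.PrimePairParity,
IwaniecInventiones1978]
#9 TypeIMainTerm (support) — shared verbatim with PolynomialMobius (stmt-Parity-0873): for every BH
system f and η ∈ (0,1) there is C > 0 with HasBatemanHornConst f C and (−1)^k Σ_{n≤x} Σ_{dᵢ ∣ fᵢ(n),
d₁⋯d_k ≤ x^{1−η}} ∏ μ(dᵢ) log dᵢ ~ C·x (elementary count with period lcm(d) ≤ x^{1−η} + log-weighted
singular series → C(f) by the prime ideal theorem). Theorem-grade, provable with effort; hypothesis
of `closes`. [difficulty: L] [stmt-Parity-0873, BatemanHorn1962, BombieriAsymptoticSieve1976,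
Literature.NumberTheory.Sieve.exists_hasBatemanHornConst]
#9 LambdaToCount (support) — shared verbatim with PolynomialMobius (stmt-Parity-0874): Σ_{n≤x} ∏ᵢ
Λ(fᵢ(n)) ~ C·x with HasBatemanHornConst f C implies BatemanHornAsymptotic f (partial summation;
proper prime-power values negligible — trivial in degree 2). Theorem-grade; hypothesis of `closes`.
[difficulty: M] [stmt-Parity-0874, BatemanHorn1962, IwaniecKowalski2004]
#9 TwoCmTail (support) — the typed SLICE (review caveat (a) of TwoCMLines): X_PM at k = 2, f = F =
(X²+1, X²+3), written in (d₁,d₂)-coordinates — there is η ∈ (0,1) with Σ_{n≤x} Σ_{d₁ ∣ n²+1, d₂ ∣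
n²+3, d₁d₂ > x^{1−η}} μ(d₁) log d₁ · μ(d₂) log d₂ = o(x). Equivalent to the (2, F)-instance of
PolyMobiusTail (piFinset over Fin 2 ≃ pairs; (F 0).eval n = n²+1, (F 1).eval n = n²+3; F is a BH
system: ω(2) = ω(3) = 1, ω(p) ≤ 4), hence to Λ-weighted BH for the pair given TypeIMainTerm at (2,
F, η); the conclusion of SliceGlue. Open (it is BH for F up to theorem-grade glue) — filed as
support because it is a special case of the target, not a separately staffed crux. [difficulty:
open-problem] [stmt-Parity-0870, BatemanHorn1962, REVIEW-TwoCMLines.md]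
#9 SliceGlue (support) — the region bookkeeping ON the typed chain (review caveat (b)):
CrossedMoebius → MixedTail → JointCofactor → TwoCmTail. Proof (provable now, ~60 lines): take η =
1/8 in the three hypotheses; for d₁, d₂ ≥ 1 and Y = x^{7/8} ≤ Z = x^{9/8} the indicator of {Y <
d₁d₂} is the sum of the three region indicators ({d₁,d₂ ≤ Y, Y < d₁d₂} ⊔ {(Y < d₁ ∨ Y < d₂) ∧ (d₁ ≤
Z ∨ d₂ ≤ Z)} ⊔ {Z < d₁ ∧ Z < d₂}; the pointwise equivalence is checked in Sketch.lean, x = 0 is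
vacuous), so the slice sum is the sum of the three region sums (Finset.sum_add_distrib,
if-splitting) and IsLittleO.add closes. [difficulty: provable-now] [Mathlib
Asymptotics.IsLittleO.add, REVIEW-TwoCMLines.md]
#9 CrossedCRT (support) — crossed twisted multiplicativity, the route's dictionary lemma, Weyl sums
inlined (rfl-equal to polyRootWeylSum f c₁ (h e₂) · polyRootWeylSum g c₂ (h e₁)): for coprime c₁, c₂
with c₁e₁ ≡ 1 (c₂), c₂e₂ ≡ 1 (c₁), any f, g ∈ ℤ[X] and h ∈ ℤ, Σ_{ν mod c₁c₂: c₁ ∣ f(ν), c₂ ∣ g(ν)}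
e(hν/(c₁c₂)) = S_f(h e₂; c₁)·S_g(h e₁; c₂). Same proof as Hooley's Lemma 1 for one polynomial (tree:
Literature.NumberTheory.Sieve.polyRootWeylSum_mul_of_coprime, stdAddChar_mul_eq_mul_of_coprime) with
f on one side and g on the other (ν ≡ ν₁c₂e₂ + ν₂c₁e₁); degenerate c₁c₂ = 0 holds trivially (both
sides 0). Provable now (~40 lines). [difficulty: provable-now] [Hooley1964,
Literature.NumberTheory.Sieve.polyRootWeylSum_mul_of_coprime, MartinSitar2010]
#9 QuarticRootsEquidistribution (support) — qualitative rung under crux 5 (Weyl sum inlined): for h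
≠ 0, Σ_{c≤N} S_P(h; c) = o(N log N), P = (X²+1)(X²+3) (the ≍ N log N roots ν/c of P up to N are
equidistributed mod 1 in Hooley's measure). Hooley's 1964 argument uses irreducibility only through
the root-density input; for P the mean of √ρ_P(p) over primes is ¼·2 + ½·√2 = 1.207 < 2 = mean
ρ_P(p), so the tree's proof of hooley_polyRoots_logPowerSaving adapts (saving (log N)^{0.79−o(1)} on
Σ|S_P|); Kowalski–Soundararajan state the reducible case (Thm 2.1, Remark 2.5(1)). Provable with
effort. [difficulty: L] [arXiv:2003.12965, Hooley1964,
Literature.NumberTheory.Sieve.hooley_polyRoots_logPowerSaving_holds, arXiv:1802.09090,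
MartinSitar2010]
#9 JointMoebiusAtom (support) — the unweighted joint atom (special case (e₁,e₂) = (1,1) of crux 2
without logs; numerically testable, the route's cheapest falsifier): Σ_{n≤x} μ(n²+1)μ(n²+3) = o(x)
(μ(n²+3) = 0 for odd n since 4 ∣ n²+3, so only even n count). Open (k = 2 polynomial Chowla,
μ-form); TwoCMLines numerics: 6, 63, −391, −10, 405 at x = 10³, 10⁴, 10⁵, 3·10⁵, 10⁶, |J(y)| ≤
1.46√y to 2·10⁶. [difficulty: open-problem] [arXiv:2010.07924, stmt-Parity-0615, stmt-Parity-0871]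

TWO-LAYER PLAN. Foreseen glued splits (nothing filed now; k ≤ 3, depth 1). QuarticRootsPowerSaving ⇐
LopsidedUniform (Σ_{c₁ ≡ b (c₂), c₁ ≤ N/c₂}
S_{c₂²X²+1}(h; c₁) ≪ (N/c₂)^{1−δ} uniformly for c₂ ≤ N^θ, and symmetrically) → BalancedCrossed (c₁,
c₂ ∈ [N^θ, N^{1−θ}]: any power
saving in the crossed bilinear Salié sum) → QuarticRootsPowerSaving. MixedDivisor ⇐ PairLevelBeyondX
(Σ_{c₁∼M, c₂∼N}(A_{c₁,c₂}(x) −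
xρ₁ρ₂/c₁c₂) ≪ x^{1−δ} for MN ≤ x^{1+θ}) → FineScaleJoint (o(1)-saving up to MN ≤ x², smooth weights)
→ MixedDivisor. CrossedMoebius ⇐
CrossedTypeI2 (one variable opened by Heath-Brown's identity into a long smooth factor: sums of
Salié sums over the modulus,
Kuznetsov/DI) → CrossedTypeII (general α, β, x^{η/2} ≤ M, N ≤ x^{1−η}, MN ≤ x^{1+θ}) →
CrossedMoebius. MixedTail ⇐ TwistedTails (min dᵢ
≤ Y: k = 1 tails along root progressions) → JointWindow (Y < min dᵢ ≤ Z) → MixedTail. JointCofactor: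
no split before the
JointMoebiusAtom numerics at 10⁸–10⁹.

KILL CRITERIA. PolyMobiusTail refuted (a BH system with a biased Möbius tail) while TypeIMainTerm ∧
LambdaToCount are proved ⇒ ¬BatemanHorn: file it
(shared kill with PolynomialMobius/CyclotomicTower). JointCofactor refuted by an Ω(x) joint bias, or
JointMoebiusAtom refuted by a drift
|J(x)| > 10⁻³x at 10⁸–10⁹ ⇒ the F-slice itself is in doubt: close `refuted:JointCofactor` (resp.
retire with the census) and report the
witness against BH for F loudly. CrossedMoebius or MixedTail refuted at ONE η < 1/4 but not all ⇒
misstated, re-cut (new item with the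
surviving η-range, SliceGlue re-certified at that η); at all small η ⇒ close.
QuarticRootsPowerSaving refuted by a secondary term C_h·N ⇒
restate with the term (engine survives); by Ω(N^{1−o(1)}) ⇒ the crossed-Salié engine is dead — close
`refuted:QuarticRootsPowerSaving`
(the decomposition survives as the (2,F)-slice of PolynomialMobius). MixedDivisor refuted (M(x)/(x
log²x) provably oscillates) ⇒ the
joint singular-series heuristic fails for divisors already: close and record as a barrier candidate.
TypeIMainTerm refuted ⇒ shared
normalisation error; PolynomialMobius tenure re-derives, this route follows. PolyMobiusTail proved
elsewhere ⇒ close `superseded`.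

NOT DECOMPOSED YET. The Heath-Brown/Vaughan opening of μ(d₁), μ(d₂) inside CrossedMoebius; the
h-aspect (pair level beyond N) of the quartic's root sums;
uniformity of Bykovskiĭ-type bounds in the level (c₂²-dependence, θ = 7/64 losses); the p = 2, 3 and
non-squarefree bookkeeping behind
CrossedCRT-expansions of S_P; the support fact that F is a BH system (TwoCmSystem of the retired
route, provable now — re-filed only if a
prover of the (2,F)-instance equivalence asks); the general-coefficient failure lemma (one modulus >
2x) as a formal negative statement;
other discriminant pairs and k ≥ 3 (k-fold crossed products); the frame X itself beyond the F-slice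
(PolynomialMobius' business).

CHEAPEST FALSIFIER. (1) JointMoebiusAtom numerics J(x) = Σ_{n≤x} μ(n²+1)μ(n²+3) to 10⁸–10⁹
(root-sieve factorisation of n²+1, n²+3; card
parity-atoms-certified-numerics has the kit recipe): TwoCMLines found J = 6, 63, −391, −10, 405 at x
= 10³…10⁶ and max_{100<y≤2·10⁶}
|J(y)|/√y = 1.45; the refuter's regional pieces to 10⁶ (|piece|/x ≤ 0.27, fluctuating sign; kit
j000959 at 3·10⁶, 10⁷) — a drift
|J(x)| > 10⁻³x kills the atom and the slice. (2) Σ_{c≤N} S_P(h; c)/N for N to 10⁷, h = 1…5: a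
nonzero limit kills the O(N^{1−δ}) form of
crux 5 (TwoCMLines: |Σ| ≤ 2.1√N for N ≤ 8000). (3) Lookup: a quantitative treatment of root Weyl
sums for a product of two irreducible
QUADRATICS (sequels of arXiv:1802.09090; papers citing arXiv:2003.12965) would make crux 5 `known` —
none found (searches in Novelty).
I could not run kit myself in this session (plancard seat; compute not in scope); lit searchd was
unavailable (rc 75).

NUMBERS. C(F) = 2.954307 (Euler product to 2·10⁶, accelerated by L(1,χ₋₄)L(1,χ₋₃)). π_F(x) = 28,
120, 689, 4663 at x = 10³, 10⁴, 10⁵, 10⁶ vs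
C(F)·Σ_{n≤x} 1/(log(n²+1)log(n²+3)) = 28.9, 123.1, 701.8, 4617.1 (ratios 0.97–1.01). M(x)/(x log²x)
= 1.978, 1.879, 1.821, 1.784 at x =
10³…10⁶. TypeI piece/x → C(F) = 2.954 and |regional pieces|/x ≤ 0.27 at 10⁶ (refuter
REVIEW-TwoCMLines.md). One-quadratic benchmarks at
P = x^α (n²+1): Type I level x^{1−ε}P^{−1/2} (DeshouillersIwaniec1982), x^{(32−7α)/50−η}
(doi:10.4171/jems/951, θ = 7/64); Type II
x^{α−1+η} ≪ N ≪ x^{(57−32α)/96−η} (arXiv:1908.08816); window Type I for D ≤ X^{1/2}, Type II for N ≤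
X^{1/4}, P⁺(n²+h) > n^{1.312}
(arXiv:2505.00493). Hooley data for P: ρ_P(p) ∈ {0,2,4} with densities ¼, ½, ¼ (p mod 12); ρ_P(2^a)
= 1, 2, 4, 0 (a = 1, 2, 3, ≥ 4).
Items at open: 14 (target 1, cruxes 5, support 7, assembly 1);
PolyMobiusTail/TypeIMainTerm/LambdaToCount/Assembly shared verbatim with
route-Parity-PolynomialMobius (0870/0873/0874/0875).

DEFINITION REQUESTS. None. Everything is elementary over Mathlib (Nat.divisors,
ArithmeticFunction.moebius/vonMangoldt, Complex.exp, Int.ModEq, Polynomial.eval)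
plus the prelude notions IsBatemanHornSystem / HasBatemanHornConst / BatemanHornAsymptotic reached
through Summits.Parity.Statement; the
Weyl sums are inlined (ScratchWeyl.lean: simp/rfl-equal to
Literature.NumberTheory.Sieve.polyRootWeylSum) so that no unproved
Literature fact enters the import cone. If crux 5 gets staffed, a notion `jointRootWeylSum f g c₁ c₂
h` would be worth a definition item.

Novelty: Searches (2026-08-15, this seat): `lit search "divisor function product of two irreducible quadratic
polynomials asymptotic"` (searchd rc
75, unavailable); `lit galaxy search "n^2+1 and n^2+3" --star all` (0/0/0); `lit galaxy search
"roots of polynomial congruences" --star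
pdf` (4: Dartyge–Martin hal-02311450 = arXiv:1802.09090, Järviniemi arXiv:2006.00941, two
unrelated); `lit galaxy search "sums of Salié
sums" --star all` (1: Duke preprint bounds3.pdf); `lit search --source crossref "average of divisor
function over values of polynomial"`
(15: Liu–Masri doi:10.1090/proc/12495, Lapkova–Zhou doi:10.1007/s11139-019-00240-2 — one quadratic;
nothing on a product of two
quadratics); `lit search --source crossref "almost prime values of products of irreducible quadratic
polynomials sieve"` (12: Franze–Kao
doi:10.1016/j.jnt.2019.09.013, Irving doi:10.1112/blms/bdv035 — weighted-sieve P_r results, no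
root-sum engine); `lit search --source
zbmath "simultaneous prime values of two quadratic polynomials"` (5, none relevant); plus the gen-1
searches recorded in
Theses/TwoCMLines.lean (frontier/bridges ×2, crossref ×4, zbmath ×4, galaxy ×5, reads of
arXiv:2003.12965 pp.6–8, arXiv:1802.09090
pp.3–4, arXiv:1908.08816 pp.3,5,11,17) and the grounders' g14-20/g13-26 searches cited in the
refuter grade.
Nearest prior art found: route-Parity-PolynomialMobius (0870/0873/0874: the frame, engine-free);
DukeFriedlanderIwaniec1995 + Toth2000
(root machinery for ONE quadratic); arXiv:1802.09090 (Dart  [refs: 10.1090/proc/12495, 10.1007/s11139-019-00240-2, 10.1016/j.jnt.2019.09.013, 10.1112/blms/bdv035, 10.4171/jems/951., 1802.09090, 2006.00941, 2003.12965, 1908.08816, 2505.00493, doi:10.1090/proc/12495, doi:10.1007/s11139-019-00240-2, doi:10.1016/j.jnt.2019.09.013, doi:10.1112/blms/bdv035, doi:10.4171/jems/951., DukeFriedlanderIwaniec1995, Toth2000]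

Barriers (technique_class: crossed-salie-bilinear kuznetsov type-I2 quadratic-pairs): - technique_class: crossed-salie-bilinear kuznetsov type-I2 quadratic-pairs
- Literature.Barriers.Parity.SelbergParityBarrier: applies to the frame and is NOT evaded — Type-I
data of level x^{1−η} fix only TypeIMainTerm
(Literature.NumberTheory.Sieve.bombieri_asymptotic_sieve_indeterminacy) and PolyMobiusTail carries
the whole parity content, as in PolynomialMobius; inside the slice parity is NAMED and isolated in
JointCofactor and MixedTail, while CrossedMoebius, QuarticRootsPowerSaving and MixedDivisor are
equidistribution statements with both moduli below x (Type-II-shaped on the modulus side), which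
Selberg's examples do not obstruct.
- Literature.Barriers.Parity.PrimePairParity: applies verbatim — (n²+1, n²+3) IS a prime pair and no
sieve-theoretic deduction from discrepancy bounds is attempted; the bet is the evasion the source
itself names (bilinear sums with Λ/μ on the far variable), here MixedTail (μ(d) log d against
Λ-tails of the other factor along root progressions) plus the joint atom.
- Literature.Barriers.Parity.FordMaynardLowLevel: applies on the VALUE side (P(n) ≤ x⁴ takes x
values, c = 1/4 < 1/2: no Type-I/II scheme detects primes; each factor alone c = 1/2); the route's
Type-I/II information lives on the MODULUS side (positive-density root sequences, where
FordMaynard2024 Thm 2.5's (1/2, 0, 1/3) holds); it does not evade the barrier for JointCofactor —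
honest parity bet.
- Literature.Barriers.Parity.FordMaynardMinimalTypeII: CrossedMoebius is Type II in the

Novelty grade: new-combination — ROUTE REVIEW (refuter-rreview-0815T18-21-0, 2026-08-15): SOUND, keep open, staffable (cone 24/0 unproved). Conforming successor of TwoCMLines (retired 13:50Z for FORM only; prior review grade new-combination carried: PolynomialMobius product-cutoff tail split x Hooley/DFI/Toth root-congruence machin (refuter refuter-rreview-0815T18-21-0, 2026-08-15T19:45:25Z; prior: route-Parity-PolynomialMobius (stmt-Parity-0870/0873/0874), Hooley1964, DukeFriedlanderIwaniec1995, Toth2000, arXiv:1908.08816, arXiv:1802.09090, arXiv:2003.12965, doi:10.4171/jems/951, route-Parity-TwoCMLines (retired, same card))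

History (route lifecycle, newest last):
- 2026-08-16T04:13:20Z · AUTO-CRUX (backfill): PolyMobiusTail — hypotheses of the deciding theorem that nothing in the route derives are cruxes (operator:999:1085951)
- 2026-08-24T17:55:32Z · DORMANT — reconciler: no traction for 6.9 d (last activity item-evidence-added at 2026-08-17T18:31:59Z); parked, not closed — `ledger route dormant route-Parity-CrossedSa (operator:999:701227)

sub-problem: BatemanHorn · status: dormant · opened planner-plancard-Parity-BatemanHorn-two-cm-li-c073299a-g2-0 2026-08-15T18:50:28Z · rev 1 · ledger route-Parity-CrossedSalie
GENERATED by the gate from the ledger (D-0016/17). Provers cite these decls: `theorem foo : Summit.Parity.BatemanHorn.Theses.CrossedSalie.<Decl> := …` in Summits/Parity/BatemanHorn/Theorems/<Name>.lean.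
-/

namespace Summit.Parity.BatemanHorn.Theses.CrossedSalie

open scoped BigOperators Topology Manifold Classical MeasureTheory ProbabilityTheory Matrix InnerProductSpace ComplexConjugate ContinuousMap
open Filter Set Function TopologicalSpace MeasureTheory

attribute [summit_statement] _root_.BatemanHorn

/-- item stmt-Parity-0870 · crux (kind.auto-crux: conjecture-grade) · rank 0 · open · by planner
why it might fail: = BatemanHorn in Λ-form modulo theorem-grade glue (Bombieri's indeterminacy: no Type-I level < 1 decides it); false iff BH fails for some system — which happens verbatim over F_q[u] for inseparable f (Conrad–Conrad–Gross).
sources: BombieriAsymptoticSieve1976, arXiv:2008.09905, Literature.Barriers.Parity.FunctionFieldMobiusBias, Literature.Barriers.Parity.FordFixedLevelBarrier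
[crux] X_PM, the Möbius tail: for every Bateman–Horn system f = (f_1..f_k) there is η ∈ (0,1) with
∑_{n≤x} ∑_{d_i | f_i(n), d_1⋯d_k > x^{1−η}} ∏_i μ(d_i) log d_i = o(x). Since ∏Λ(f_i(n)) = (−1)^k
∑_{d_i|f_i(n)} ∏ μ(d_i) log d_i and the complementary range d_1⋯d_k ≤ x^{1−η} is Type-I
(TypeIMainTerm), this is BatemanHorn minus theorem-grade glue. k = 1 reading: Möbius randomness of
the large cofactor f(n)/e along the roots of f mod e, e ≤ x^{deg f − 1 + η}. Open (parity). Sources: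
BombieriAsymptoticSieve1976 (indeterminacy), Entin2016 / SawinShusterman2018 (F_q[T] analogues are
theorems), BrowningSofosTeravainen2022 (true for 100% of f). -/
@[route_item "route-Parity-CrossedSalie", crux]
def PolyMobiusTail : Prop :=
  ∀ (k : ℕ) (f : Fin k → Polynomial ℤ), Literature.NumberTheory.Sieve.IsBatemanHornSystem f → ∃ η : ℝ, 0 < η ∧ η < 1 ∧ (fun x : ℕ => ∑ n ∈ Finset.Icc 1 x, ∑ d ∈ Fintype.piFinset (fun i => (((f i).eval (n : ℤ)).toNat).divisors), if (x : ℝ) ^ (1 - η) < ∏ i, (d i : ℝ) then ∏ i, ((ArithmeticFunction.moebius (d i) : ℝ) * Real.log (d i)) else 0) =o[Filter.atTop] fun x : ℕ => (x : ℝ)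

/-- item stmt-Parity-12160 · crux · rank 2 · open · by planner
why it might fail: k=2 Chowla-type claim along a quartic, open even for Σμ(n²+1)=o(x); a joint sign bias of μ((n²+1)/e₁)μ((n²+3)/e₂) on some root classes (CCG-type, known over F_q[u]) gives Ω(x); needs a (log x)⁴ saving over the trivial x·log⁴x, not just o(trivial).
sources: arXiv:2010.07924, Literature.Barriers.Parity.FunctionFieldMobiusBias, arXiv:2008.09905, stmt-Parity-0871, stmt-Parity-0615, REVIEW-TwoCMLines.md (refuter regional numerics to 1e6: |Joint piece|/x ≤ 0.27 with fluctuating sign)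
[crux] card item Q₁₂, the joint cofactor atom of the F-slice: for every η ∈ (0, 1/4), Σ_{n≤x} Σ_{d₁
∣ n²+1, d₂ ∣ n²+3, d₁ > x^{1+η}, d₂ > x^{1+η}} μ(d₁) log d₁ · μ(d₂) log d₂ = o(x). Cofactor reading:
dᵢ = fᵢ(n)/eᵢ with eᵢ ≲ x^{1−η}, so this is Σ_{e₁,e₂} Σ_{n≤x: eᵢ ∣ fᵢ(n)}
μ((n²+1)/e₁)μ((n²+3)/e₂)·log·log = o(x): joint Möbius randomness of the two LARGE cofactors along
the joint root classes mod e₁e₂ ≤ x^{2−2η} (fewer than one n per class on average — a correlation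
sum, not a progression statement); the (e₁,e₂) = (1,1) term is the log-weighted form of support
JointMoebiusAtom. Trivial bound ≍ x log⁴x, so a (log x)^{4+ε} saving is required. Any single η feeds
SliceGlue (which uses η = 1/8); the ∀η form is the intended robustness claim (refuted at one η ⇒
re-cut, see Kill criteria). [difficulty: open-problem] -/
@[route_item "route-Parity-CrossedSalie"]
def JointCofactor : Prop :=
  ∀ η : ℝ, 0 < η → η < 1 / 4 → (fun x : ℕ => ∑ n ∈ Finset.Icc 1 x, ∑ d₁ ∈ Nat.divisors (n ^ 2 + 1), ∑ d₂ ∈ Nat.divisors (n ^ 2 + 3), if (x : ℝ) ^ (1 + η) < (d₁ : ℝ) ∧ (x : ℝ) ^ (1 + η) < (d₂ : ℝ) then (ArithmeticFunction.moebius d₁ : ℝ) * Real.log d₁ * ((ArithmeticFunction.moebius d₂ : ℝ) * Real.log d₂) else 0) =o[Filter.atTop] fun x : ℕ => (x : ℝ)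

/-- item stmt-Parity-12161 · crux · rank 3 · open · by planner
why it might fail: Balanced corner d₁≈d₂≈x^{1−η}: x^{1−2η} frequencies and a near-square-root saving in (d₁,d₂) are needed; Cauchy–Schwarz halves savings (Merikoski Prop 4: Type II only for N<x^{0.26} at MN≈x), so μ must be opened into Type-I₂ at pair level x^{2−2η}, past MixedDivisor.
sources: arXiv:1908.08816, doi:10.4171/jems/951, DukeFriedlanderIwaniec1995, DukeFriedlanderIwaniec1997, Literature.NumberTheory.Sieve.largeSieve_quadraticRoots, FordMaynard2024PrimeSieves
[crux] card item W₁₂ in the only range where it is bilinear — the route's new object: for every η ∈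
(0, 1/4), Σ_{n≤x} Σ_{d₁ ∣ n²+1, d₂ ∣ n²+3, d₁ ≤ x^{1−η}, d₂ ≤ x^{1−η}, d₁d₂ > x^{1−η}} μ(d₁) log d₁
· μ(d₂) log d₂ = o(x). Each progression n ≡ νᵢ (dᵢ) has ≥ x^η terms but the joint modulus d₁d₂
reaches x^{2−2η} ≫ x; after Poisson in n the error is (x/d₁d₂) Σ_{0<|h|≤d₁d₂/x^{1−ε}} Σ_{d₁,d₂}
α(d₁)β(d₂) S_{X²+1}(h d̄₂; d₁) S_{X²+3}(h d̄₁; d₂) with α = β = μ·log (support CrossedCRT): a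
bilinear form in two root systems coupled by Kloosterman fractions. The x·(main terms) cancel in the
limit (A(Y)B(Y) − Σ_{d₁d₂≤Y}(a∗b) → A∞B∞ − A∞B∞ by the prime ideal theorem in ℚ(i), ℚ(√−3)), so the
content is the dual sum; lopsided parts (min dᵢ ≤ x^{η/2}) are Type I, the heart is x^{η/2} ≤ d₁, d₂
≤ x^{1−η}. [deps: CrossedCRT] [difficulty: XL] -/
@[route_item "route-Parity-CrossedSalie"]
def CrossedMoebius : Prop :=
  ∀ η : ℝ, 0 < η → η < 1 / 4 → (fun x : ℕ => ∑ n ∈ Finset.Icc 1 x, ∑ d₁ ∈ Nat.divisors (n ^ 2 + 1), ∑ d₂ ∈ Nat.divisors (n ^ 2 + 3), if (d₁ : ℝ) ≤ (x : ℝ) ^ (1 - η) ∧ (d₂ : ℝ) ≤ (x : ℝ) ^ (1 - η) ∧ (x : ℝ) ^ (1 - η) < (d₁ : ℝ) * (d₂ : ℝ) then (ArithmeticFunction.moebius d₁ : ℝ) * Real.log d₁ * ((ArithmeticFunction.moebius d₂ : ℝ) * Real.log d₂) else 0) =o[Filter.atTop] fun x : ℕ => (x : ℝ)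

/-- item stmt-Parity-12162 · crux · rank 4 · open · by planner
why it might fail: At c₁≈c₂≈x the dual sum has x³ terms (h,c₁,c₂) and must save a factor x with both moduli at the Pólya–Vinogradov edge; no automorphic object for typed roots of the reducible quartic is known (Bykovskiĭ/Kuznetsov serve one discriminant); even Στ(n²+1)² is open.
sources: Hooley1963, doi:10.1017/s0305004100073242, doi:10.1016/j.jnt.2017.05.002, doi:10.1007/s11139-019-00240-2, doi:10.1515/crll.1999.507.107, arXiv:1908.08816
[crux] the card's master Type-I₂ sum at LEADING ORDER ONLY (refuter caveat accepted: not
theorem-grade): there is c > 0 with Σ_{n≤x} τ(n²+1)·τ(n²+3) ~ c·x·log²x. For even n this is τ(P(n)),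
P = (X²+1)(X²+3); the order x·log²x is classical (two irreducible factors), the constant is not:
after flipping each factor at √fᵢ(n) ≈ n one needs #{n ≤ x : c₁ ∣ n²+1, c₂ ∣ n²+3} for c₁, c₂ ≤ x
with pair modulus c₁c₂ up to x², and the region c₁c₂ > x carries half of the logarithmic mass —
smooth-coefficient crossed Salié sums with frequencies h ≤ c₁c₂/x (fine-scale joint equidistribution
of the typed roots of P), which Σ τ(n)τ(n+1) (Ingham: pair level = length after the flips) never
needs. The power-saving form x·Q₂(log x) + O(x^{1−δ}) is the layer-2 endpoint. [deps:
QuarticRootsPowerSaving] [difficulty: XL] -/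
@[route_item "route-Parity-CrossedSalie"]
def MixedDivisor : Prop :=
  ∃ c : ℝ, 0 < c ∧ Asymptotics.IsEquivalent Filter.atTop (fun x : ℕ => ∑ n ∈ Finset.Icc 1 x, ((Nat.divisors (n ^ 2 + 1)).card : ℝ) * ((Nat.divisors (n ^ 2 + 3)).card : ℝ)) (fun x : ℕ => c * (x : ℝ) * Real.log x ^ 2)

/-- item stmt-Parity-12163 · crux · rank 5 · open · by planner
why it might fail: Balanced range c₁≈c₂≈√N: after Cauchy–Schwarz the off-diagonal is a length-√N sum of root Weyl sums twisted by Kloosterman fractions of modulus ≈N with root-entangled numerators (DFI97 needs a fixed numerator); a secondary term ≍N (as for n(n²+1), Dartyge–Martin Thm 2) falsifies the O-form.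
sources: Hooley1964, Literature.NumberTheory.Sieve.hooley_polyRoots_logPowerSaving_holds, arXiv:2003.12965, arXiv:1802.09090, MartinSitar2010, DukeFriedlanderIwaniec1997
[crux] first rung of the engine, Weyl sum inlined (no Literature import; simp-equal to Σ_{c≤N}
polyRootWeylSum ((X²+1)(X²+3)) c h, checked in ScratchWeyl.lean): for every h ≠ 0 there is δ > 0
with Σ_{c ≤ N} S_P(h; c) = O(N^{1−δ}), S_P(h; c) = Σ_{ν mod c, P(ν) ≡ 0} e(hν/c), P = (X²+1)(X²+3)
(Σ_{c≤N} ρ_P(c) ≍ N log N). For squarefree c coprime to 6 the roots of P are the CRT-glued pairs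
(root of X²+1 mod c₁, root of X²+3 mod c₂), c = c₁c₂ (odd p cannot divide both values: they differ
by 2), and S_P(h; c) = Σ_{c₁c₂ = c} S_{X²+1}(h c̄₂; c₁)·S_{X²+3}(h c̄₁; c₂): the smooth-coefficient
crossed Salié sum at a fixed frequency. A power saving is in print only for ONE irreducible
quadratic (Hooley 1963 / Bykovskiĭ / Tóth via Weil–Kloosterman); for reducible polynomials only
linear-factor cases (Dartyge–Martin Thms 1–4). For fixed c₂, S_{X²+1}(h c̄₂; c₁) = S_{c₂²X²+1}(h;
c₁), so lopsided ranges are Hooley/Bykovskiĭ for the quadratics c₂²X²+1, c₁²X²+3 over moduli in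
progressions, uniformly in the level; no secondary main term is expected (no rational root; the
residue of ν₂ mod c₂ washes out the twist). [deps: CrossedCRT, QuarticRootsEquidistribution]
[difficulty: L] -/
@[route_item "route-Parity-CrossedSalie"]
def QuarticRootsPowerSaving : Prop :=
  ∀ h : ℤ, h ≠ 0 → ∃ δ : ℝ, 0 < δ ∧ (fun N : ℕ => ∑ c ∈ Finset.Icc 1 N, ∑ ν ∈ (Finset.range c).filter (fun ν : ℕ => (c : ℤ) ∣ ((ν : ℤ) ^ 2 + 1) * ((ν : ℤ) ^ 2 + 3)), Complex.exp (2 * Real.pi * Complex.I * (h * ν / c : ℂ))) =O[Filter.atTop] fun N : ℕ => (N : ℝ) ^ (1 - δ)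

/-- item stmt-Parity-12164 · crux · rank 6 · open · by planner
why it might fail: Contains HL-E-depth parity statements for each factor (Λ-tail of n²+3 along μ-weighted root progressions of n²+1 and symmetrically); general coefficients provably fail once a modulus exceeds 2x, so only the arithmetic of μ on the large divisor can give the log⁴ saving; no Type-II range there.
sources: stmt-Parity-0648, stmt-Parity-0649, stmt-Parity-0882, arXiv:2505.00493, FordMaynard2024PrimeSieves, Literature.Barriers.Parity.PrimePairParity
[crux] card items Q′₁, Q′₂ and the beyond-x part of W₁₂: for every η ∈ (0, 1/4), Σ_{n≤x} Σ_{d₁ ∣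
n²+1, d₂ ∣ n²+3, max(d₁,d₂) > x^{1−η}, min(d₁,d₂) ≤ x^{1+η}} μ(d₁) log d₁ · μ(d₂) log d₂ = o(x).
Writing −Λ(fᵢ(n)) = Lᵢ + Wᵢ + Kᵢ (level d ≤ Y, window Y < d ≤ Z, cofactor d > Z parts; Y = x^{1−η},
Z = x^{1+η}) this is Σ_n [L₁(W₂+K₂) + (W₁+K₁)L₂ + W₁W₂ + W₁K₂ + K₁W₂]: the k = 1 window and cofactor
statements of each factor along the root progressions n ≡ ν_j (d_j), d_j ≤ x^{1−η}, of the OTHER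
factor with weights μ(d_j) log d_j (cancellation across moduli allowed and probably necessary), plus
the balanced joint window W₁W₂ (d₁ ≈ d₂ ≈ x). Together with CrossedMoebius and JointCofactor it
partitions {d₁d₂ > x^{1−η}} exactly (support SliceGlue). [difficulty: open-problem] -/
@[route_item "route-Parity-CrossedSalie"]
def MixedTail : Prop :=
  ∀ η : ℝ, 0 < η → η < 1 / 4 → (fun x : ℕ => ∑ n ∈ Finset.Icc 1 x, ∑ d₁ ∈ Nat.divisors (n ^ 2 + 1), ∑ d₂ ∈ Nat.divisors (n ^ 2 + 3), if ((x : ℝ) ^ (1 - η) < (d₁ : ℝ) ∨ (x : ℝ) ^ (1 - η) < (d₂ : ℝ)) ∧ ((d₁ : ℝ) ≤ (x : ℝ) ^ (1 + η) ∨ (d₂ : ℝ) ≤ (x : ℝ) ^ (1 + η)) then (ArithmeticFunction.moebius d₁ : ℝ) * Real.log d₁ * ((ArithmeticFunction.moebius d₂ : ℝ) * Real.log d₂) else 0) =o[Filter.atTop] fun x : ℕ => (x : ℝ)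

/-- item stmt-Parity-0873 · support · rank 9 · closed · proved by Summit.Parity.BatemanHorn.Theorems.typeIMainTerm_proof (prover) · by planner
sources: stmt-Parity-0873, BatemanHorn1962, BombieriAsymptoticSieve1976, Literature.NumberTheory.Sieve.exists_hasBatemanHornConst
[support] Type-I main term, theorem-grade: for every BH system f and η ∈ (0,1) there is C with
HasBatemanHornConst f C and (−1)^k ∑_{n≤x} ∑_{d_i | f_i(n), d_1⋯d_k ≤ x^{1−η}} ∏ μ(d_i) log d_i ~
C·x. Proof sketch: #{n ≤ x : d_i | f_i(n) ∀ i} = x ρ(d)/lcm(d) + O(ρ(d)) (period lcm(d) ≤ x^{1−η});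
the log-weighted singular series (−1)^k ∑_d ∏(μ(d_i) log d_i) ρ(d)/lcm(d) converges (ordered by the
cutoff) to the Bateman–Horn constant C(f) = ∏_p (1−1/p)^{−k}(1−ω(p)/p) by the prime ideal theorem
with error term in the splitting fields (Landau1903; BatemanHorn1962 §2; DavenportSchinzel1966; k =
1, f = X: −∑ μ(d) log d/d = 1). Named fact available:
Literature.NumberTheory.Sieve.exists_hasBatemanHornConst. Provable with substantial effort;
grounders may propose the needed Dedekind-zeta facts as Literature cites. -/
@[route_item "route-Parity-CrossedSalie", crux]
def TypeIMainTerm : Prop :=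
  ∀ (k : ℕ) (f : Fin k → Polynomial ℤ), Literature.NumberTheory.Sieve.IsBatemanHornSystem f → ∀ η : ℝ, 0 < η → η < 1 → ∃ C : ℝ, 0 < C ∧ Literature.NumberTheory.Sieve.HasBatemanHornConst f C ∧ Asymptotics.IsEquivalent Filter.atTop (fun x : ℕ => (-1 : ℝ) ^ k * ∑ n ∈ Finset.Icc 1 x, ∑ d ∈ Fintype.piFinset (fun i => (((f i).eval (n : ℤ)).toNat).divisors), if ∏ i, (d i : ℝ) ≤ (x : ℝ) ^ (1 - η) then ∏ i, ((ArithmeticFunction.moebius (d i) : ℝ) * Real.log (d i)) else 0) (fun x : ℕ => C * (x : ℝ))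

/-- item stmt-Parity-0874 · support · rank 9 · closed · proved by Summit.Parity.BatemanHorn.LambdaToCount.lambdaToCount_proof (prover) · by planner
sources: stmt-Parity-0874, BatemanHorn1962, IwaniecKowalski2004
[support] From Λ-weights to the count, theorem-grade: if ∑_{n≤x} ∏_i Λ(f_i(n)) ~ C·x with
HasBatemanHornConst f C then BatemanHornAsymptotic f (polyPrimeCount f x ~ C/(∏ deg f_i) · x/(log
x)^k). Partial summation (Λ(f_i(n)) = log f_i(n) = deg f_i · log n + O(1) at prime values) plus
negligibility of proper prime-power values f_i(n) = p^a, a ≥ 2: O(x^{1/2+ε}) — trivial for deg ≤ 2,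
Bombieri–Pila / Siegel integral points on y^a = f_i(x) for deg ≥ 3. C > 0 by
Literature.NumberTheory.Sieve.exists_hasBatemanHornConst. -/
@[route_item "route-Parity-CrossedSalie", crux]
def LambdaToCount : Prop :=
  ∀ (k : ℕ) (f : Fin k → Polynomial ℤ), Literature.NumberTheory.Sieve.IsBatemanHornSystem f → ∀ C : ℝ, 0 < C → Literature.NumberTheory.Sieve.HasBatemanHornConst f C → Asymptotics.IsEquivalent Filter.atTop (fun x : ℕ => ∑ n ∈ Finset.Icc 1 x, ∏ i, ArithmeticFunction.vonMangoldt (((f i).eval (n : ℤ)).toNat)) (fun x : ℕ => C * (x : ℝ)) → Literature.NumberTheory.Sieve.BatemanHornAsymptotic f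

/-- item stmt-Parity-12165 · support · rank 9 · open · by planner
sources: stmt-Parity-0870, BatemanHorn1962, REVIEW-TwoCMLines.md
[support] the typed SLICE (review caveat (a) of TwoCMLines): X_PM at k = 2, f = F = (X²+1, X²+3),
written in (d₁,d₂)-coordinates — there is η ∈ (0,1) with Σ_{n≤x} Σ_{d₁ ∣ n²+1, d₂ ∣ n²+3, d₁d₂ >
x^{1−η}} μ(d₁) log d₁ · μ(d₂) log d₂ = o(x). Equivalent to the (2, F)-instance of PolyMobiusTail
(piFinset over Fin 2 ≃ pairs; (F 0).eval n = n²+1, (F 1).eval n = n²+3; F is a BH system: ω(2) =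
ω(3) = 1, ω(p) ≤ 4), hence to Λ-weighted BH for the pair given TypeIMainTerm at (2, F, η); the
conclusion of SliceGlue. Open (it is BH for F up to theorem-grade glue) — filed as support because
it is a special case of the target, not a separately staffed crux. [difficulty: open-problem] -/
@[route_item "route-Parity-CrossedSalie"]
def TwoCmTail : Prop :=
  ∃ η : ℝ, 0 < η ∧ η < 1 ∧ (fun x : ℕ => ∑ n ∈ Finset.Icc 1 x, ∑ d₁ ∈ Nat.divisors (n ^ 2 + 1), ∑ d₂ ∈ Nat.divisors (n ^ 2 + 3), if (x : ℝ) ^ (1 - η) < (d₁ : ℝ) * (d₂ : ℝ) then (ArithmeticFunction.moebius d₁ : ℝ) * Real.log d₁ * ((ArithmeticFunction.moebius d₂ : ℝ) * Real.log d₂) else 0) =o[Filter.atTop] fun x : ℕ => (x : ℝ)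

/-- item stmt-Parity-12166 · support · rank 9 · open · by planner
sources: Mathlib Asymptotics.IsLittleO.add, REVIEW-TwoCMLines.md
[support] the region bookkeeping ON the typed chain (review caveat (b)): CrossedMoebius → MixedTail
→ JointCofactor → TwoCmTail. Proof (provable now, ~60 lines): take η = 1/8 in the three hypotheses;
for d₁, d₂ ≥ 1 and Y = x^{7/8} ≤ Z = x^{9/8} the indicator of {Y < d₁d₂} is the sum of the three
region indicators ({d₁,d₂ ≤ Y, Y < d₁d₂} ⊔ {(Y < d₁ ∨ Y < d₂) ∧ (d₁ ≤ Z ∨ d₂ ≤ Z)} ⊔ {Z < d₁ ∧ Z <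
d₂}; the pointwise equivalence is checked in Sketch.lean, x = 0 is vacuous), so the slice sum is the
sum of the three region sums (Finset.sum_add_distrib, if-splitting) and IsLittleO.add closes.
[difficulty: provable-now] -/
@[route_item "route-Parity-CrossedSalie"]
def SliceGlue : Prop :=
  CrossedMoebius → MixedTail → JointCofactor → TwoCmTail

/-- item stmt-Parity-12167 · support · rank 9 · open · by planner
sources: Hooley1964, Literature.NumberTheory.Sieve.polyRootWeylSum_mul_of_coprime, MartinSitar2010
[support] crossed twisted multiplicativity, the route's dictionary lemma, Weyl sums inlined
(rfl-equal to polyRootWeylSum f c₁ (h e₂) · polyRootWeylSum g c₂ (h e₁)): for coprime c₁, c₂ with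
c₁e₁ ≡ 1 (c₂), c₂e₂ ≡ 1 (c₁), any f, g ∈ ℤ[X] and h ∈ ℤ, Σ_{ν mod c₁c₂: c₁ ∣ f(ν), c₂ ∣ g(ν)}
e(hν/(c₁c₂)) = S_f(h e₂; c₁)·S_g(h e₁; c₂). Same proof as Hooley's Lemma 1 for one polynomial (tree:
Literature.NumberTheory.Sieve.polyRootWeylSum_mul_of_coprime, stdAddChar_mul_eq_mul_of_coprime) with
f on one side and g on the other (ν ≡ ν₁c₂e₂ + ν₂c₁e₁); degenerate c₁c₂ = 0 holds trivially (both
sides 0). Provable now (~40 lines). [difficulty: provable-now] -/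
@[route_item "route-Parity-CrossedSalie"]
def CrossedCRT : Prop :=
  ∀ (f g : Polynomial ℤ) (c₁ c₂ : ℕ), c₁.Coprime c₂ → ∀ e₁ e₂ : ℤ, (c₁ : ℤ) * e₁ ≡ 1 [ZMOD c₂] → (c₂ : ℤ) * e₂ ≡ 1 [ZMOD c₁] → ∀ h : ℤ, (∑ ν ∈ (Finset.range (c₁ * c₂)).filter (fun ν : ℕ => (c₁ : ℤ) ∣ f.eval (ν : ℤ) ∧ (c₂ : ℤ) ∣ g.eval (ν : ℤ)), Complex.exp (2 * Real.pi * Complex.I * ((h : ℂ) * (ν : ℂ) / ((c₁ * c₂ : ℕ) : ℂ)))) = (∑ ν ∈ (Finset.range c₁).filter (fun ν : ℕ => (c₁ : ℤ) ∣ f.eval (ν : ℤ)), Complex.exp (2 * Real.pi * Complex.I * ((h * e₂ : ℤ) * ν / c₁ : ℂ))) * (∑ ν ∈ (Finset.range c₂).filter (fun ν : ℕ => (c₂ : ℤ) ∣ g.eval (ν : ℤ)), Complex.exp (2 * Real.pi * Complex.I * ((h * e₁ : ℤ) * ν / c₂ : ℂ)))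

/-- item stmt-Parity-12168 · support · rank 9 · open · by planner
sources: arXiv:2003.12965, Hooley1964, Literature.NumberTheory.Sieve.hooley_polyRoots_logPowerSaving_holds, arXiv:1802.09090, MartinSitar2010
[support] qualitative rung under crux 5 (Weyl sum inlined): for h ≠ 0, Σ_{c≤N} S_P(h; c) = o(N log
N), P = (X²+1)(X²+3) (the ≍ N log N roots ν/c of P up to N are equidistributed mod 1 in Hooley's
measure). Hooley's 1964 argument uses irreducibility only through the root-density input; for P the
mean of √ρ_P(p) over primes is ¼·2 + ½·√2 = 1.207 < 2 = mean ρ_P(p), so the tree's proof of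
hooley_polyRoots_logPowerSaving adapts (saving (log N)^{0.79−o(1)} on Σ|S_P|);
Kowalski–Soundararajan state the reducible case (Thm 2.1, Remark 2.5(1)). Provable with effort.
[difficulty: L] -/
@[route_item "route-Parity-CrossedSalie"]
def QuarticRootsEquidistribution : Prop :=
  ∀ h : ℤ, h ≠ 0 → (fun N : ℕ => ∑ c ∈ Finset.Icc 1 N, ∑ ν ∈ (Finset.range c).filter (fun ν : ℕ => (c : ℤ) ∣ ((ν : ℤ) ^ 2 + 1) * ((ν : ℤ) ^ 2 + 3)), Complex.exp (2 * Real.pi * Complex.I * (h * ν / c : ℂ))) =o[Filter.atTop] fun N : ℕ => (N : ℝ) * Real.log N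

/-- item stmt-Parity-12169 · support · rank 9 · open · by planner
sources: arXiv:2010.07924, stmt-Parity-0615, stmt-Parity-0871
[support] the unweighted joint atom (special case (e₁,e₂) = (1,1) of crux 2 without logs;
numerically testable, the route's cheapest falsifier): Σ_{n≤x} μ(n²+1)μ(n²+3) = o(x) (μ(n²+3) = 0
for odd n since 4 ∣ n²+3, so only even n count). Open (k = 2 polynomial Chowla, μ-form); TwoCMLines
numerics: 6, 63, −391, −10, 405 at x = 10³, 10⁴, 10⁵, 3·10⁵, 10⁶, |J(y)| ≤ 1.46√y to 2·10⁶.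
[difficulty: open-problem] -/
@[route_item "route-Parity-CrossedSalie"]
def JointMoebiusAtom : Prop :=
  (fun x : ℕ => ∑ n ∈ Finset.Icc 1 x, (ArithmeticFunction.moebius (n ^ 2 + 1) : ℝ) * (ArithmeticFunction.moebius (n ^ 2 + 3) : ℝ)) =o[Filter.atTop] fun x : ℕ => (x : ℝ)

/-- item stmt-Parity-0875 · assembly · rank 1 · open · by planner
sources: BombieriAsymptoticSieve1976, BatemanHorn1962, stmt-Parity-0875
[assembly] PolyMobiusTail → TypeIMainTerm → LambdaToCount → BatemanHorn. Given k, f,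
IsBatemanHornSystem f: take η from PolyMobiusTail; ∏_i Λ(f_i(n)) = (−1)^k ∑_{d ∈ ∏ divisors(f_i(n))}
∏_i μ(d_i) log d_i (Mathlib ArithmeticFunction.sum_moebius_mul_log_eq per coordinate,
Finset.prod_sum); split at ∏ d_i ≤ x^{1−η} (TypeIMainTerm: ~ C x) vs > x^{1−η} (tail: o(x));
IsEquivalent.add_isLittleO gives ∑∏Λ ~ C x (C ≠ 0 via
Literature.NumberTheory.Sieve.exists_hasBatemanHornConst or directly); LambdaToCount concludes
BatemanHornAsymptotic f; BatemanHorn := Literature.NumberTheory.Sieve.BatemanHornConjecture is ∀ k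
f, IsBatemanHornSystem f → BatemanHornAsymptotic f. Provable now (bookkeeping only). -/
@[route_item "route-Parity-CrossedSalie"]
def Assembly : Prop :=
  PolyMobiusTail → TypeIMainTerm → LambdaToCount → _root_.BatemanHorn

/-! D-0027 §2.1 — DECIDING THEOREM (planner-authored via `route open/edit --closes-file`; by planner-plancard-Parity-BatemanHorn-two-cm-li-c073299a-g2-0 2026-08-15T18:50:30Z):
its hypotheses are this route's items and its conclusion the sub-problem Statement (glue_lint), and it elaborates with this file. -/

/-- D-0027 §2.1 deciding theorem of route CrossedSalie: the three frame items `PolyMobiusTail`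
(target, shared with PolynomialMobius stmt-Parity-0870), `TypeIMainTerm` and `LambdaToCount`
(support, 0873/0874) imply the sub-problem statement `BatemanHorn`
(= `Literature.NumberTheory.Sieve.BatemanHornConjecture`). Bookkeeping of the thesis:
`∏ᵢ Λ(fᵢ(n)) = (−1)^k ∑_{dᵢ ∣ fᵢ(n)} ∏ᵢ μ(dᵢ) log dᵢ` (Mathlib `ArithmeticFunction.sum_moebius_mul_log_eq`
per coordinate, `Finset.prod_neg`, `Finset.prod_univ_sum`), the split of the divisor sum at
`∏ dᵢ ≤ x^{1−η}` versus `x^{1−η} < ∏ dᵢ`, then `IsEquivalent.add_isLittleO` and `LambdaToCount`.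
The route's own cruxes bear on the (2, (X²+1, X²+3))-slice of `PolyMobiusTail` through the support
items `SliceGlue : CrossedMoebius → MixedTail → JointCofactor → TwoCmTail`. -/
@[closes "route-Parity-CrossedSalie"] theorem closes (hTail : PolyMobiusTail) (hMain : TypeIMainTerm) (hCount : LambdaToCount) :
    _root_.BatemanHorn := by
  intro k f hf
  obtain ⟨η, hη0, hη1, hT⟩ := hTail k f hf
  obtain ⟨C, hC, hHas, hM⟩ := hMain k f hf η hη0 hη1
  refine hCount k f hf C hC hHas ?_
  -- Λ = -(μ · log) ∗ 1, coordinatewise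
  have hΛ : ∀ m : ℕ, ArithmeticFunction.vonMangoldt m
      = -∑ e ∈ m.divisors, ((ArithmeticFunction.moebius e : ℝ) * Real.log e) := by
    intro m
    have h := ArithmeticFunction.sum_moebius_mul_log_eq (n := m)
    simp only [ArithmeticFunction.log_apply] at h
    linarith
  -- step A: the product of the `Λ(fᵢ(n))` as a signed sum over divisor tuples
  have stepA : ∀ n : ℕ, (∏ i, ArithmeticFunction.vonMangoldt (((f i).eval (n : ℤ)).toNat))
      = (-1 : ℝ) ^ k * ∑ d ∈ Fintype.piFinset (fun i => (((f i).eval (n : ℤ)).toNat).divisors),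
          ∏ i, ((ArithmeticFunction.moebius (d i) : ℝ) * Real.log (d i)) := by
    intro n
    simp_rw [hΛ]
    rw [Finset.prod_neg, Finset.card_univ, Fintype.card_fin, Finset.prod_univ_sum]
  -- step B: the divisor sum splits into the Type-I range and the tail (complementary cut-offs)
  have stepB : ∀ x n : ℕ,
      (∑ d ∈ Fintype.piFinset (fun i => (((f i).eval (n : ℤ)).toNat).divisors),
          ∏ i, ((ArithmeticFunction.moebius (d i) : ℝ) * Real.log (d i)))
      = (∑ d ∈ Fintype.piFinset (fun i => (((f i).eval (n : ℤ)).toNat).divisors),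
          if ∏ i, (d i : ℝ) ≤ (x : ℝ) ^ (1 - η) then
            ∏ i, ((ArithmeticFunction.moebius (d i) : ℝ) * Real.log (d i)) else 0)
        + (∑ d ∈ Fintype.piFinset (fun i => (((f i).eval (n : ℤ)).toNat).divisors),
          if (x : ℝ) ^ (1 - η) < ∏ i, (d i : ℝ) then
            ∏ i, ((ArithmeticFunction.moebius (d i) : ℝ) * Real.log (d i)) else 0) := by
    intro x n
    rw [← Finset.sum_add_distrib]
    refine Finset.sum_congr rfl fun d _ => ?_
    by_cases h : ∏ i, (d i : ℝ) ≤ (x : ℝ) ^ (1 - η)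
    · rw [if_pos h, if_neg (not_lt.mpr h), add_zero]
    · rw [if_neg h, if_pos (not_le.mp h), zero_add]
  -- the tail, times `(-1)^k`, is `o(C·x)`
  have hB := (hT.const_mul_left ((-1 : ℝ) ^ k)).trans_isBigO
    (Asymptotics.isBigO_self_const_mul hC.ne' (fun x : ℕ => (x : ℝ)) Filter.atTop)
  refine (hM.add_isLittleO hB).congr_left (Filter.Eventually.of_forall fun x => ?_)
  simp only [Pi.add_apply]
  rw [← mul_add, ← Finset.sum_add_distrib, Finset.mul_sum]
  refine Finset.sum_congr rfl fun n _ => ?_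
  rw [stepA n, stepB x n]

end Summit.Parity.BatemanHorn.Theses.CrossedSalie
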